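import Literature.NumberTheory.LFunctions.ZetaLowHeightZeros
import HarnessLib

/-!
# Kernel-checked certificate: `ζ ≠ 0` on `(0, ½) × (15/2, 11]`

Trunk T-ANT (NumberTheory/LFunctions). One of the seven certificate files of the certified
low-height computation behind `Literature.NumberTheory.LFunctions.speiser_iff` (Levinson–Montgomery's Theorem 1 (1.2) needs
`ζ ≠ 0` on `(0,½) × (0, 10.5]` and `ζ' ≠ 0` on `(0,½) × (0, 10]`; classically Gram 1903 and
Spira 1965). The literal `Literature.NumberTheory.LFunctions.ZetaLowHeightZeros.ZetaNum.certZeta7hto11` lists, for the four edges of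
`[0, ½] × [15/2, 11]`, pieces with quadrant labels (scaled integers at `2^48`); it was produced by
an external planner that mirrors the checker bit for bit, but its validity rests only on the
kernel evaluation `Literature.RH.ZetaNum.certZeta7hto11_ok : certCheck 0 certZeta7hto11 = true`
(`decide +kernel`, Euler–Maclaurin `N = 6` enclosures in fixed-point interval arithmetic and the
winding-number certificate theorem; see `ZetaLowHeightZeros.lean`). No axioms beyond
`propext`, `Classical.choice`, `Quot.sound`.

## Main results

* `Literature.NumberTheory.LFunctions.ZetaLowHeightZeros.ZetaNum.certZeta7hto11_ok` — the kernel check.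
* `Literature.NumberTheory.LFunctions.ZetaLowHeightZeros.ZetaNum.riemannZeta_ne_zero_Zeta7hto11` — `ζ(s) ≠ 0` for `0 < Re s < ½`, `15/2 < Im s ≤ 11`.
-/

namespace Literature.NumberTheory.LFunctions.ZetaLowHeightZeros.ZetaNum

/-- The certificate data for `ζ` on `[0, ½] × [15/2, 11]` (bottom, right, top, left edges).
[folklore] -/
def certZeta7hto11 : ZetaNum.Cert :=
  ⟨2111062325329920, 3096224743817216, 140737488355328, 0, [],
  2254561477656576, 0, [(2406872829132800, 0), (2567212548227072, 0), (2732541945577472, 0), (2898187023024128, 0), (3059095825285120, 0), (3096224743817216, 0)],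
  140737488355328, 0, [],
  2211030910369792, 0, [(2316489537355776, 0), (2427712010452992, 0), (2543680422412288, 0), (2664211163381760, 0), (2787415521492992, 0), (2910877577641984, 0), (3032265164587008, 0), (3096224743817216, 0)]⟩

/-- **The kernel check of the certificate.** [folklore] -/
theorem certZeta7hto11_ok : ZetaNum.certCheck 0 certZeta7hto11 = true := by
  decide +kernel

/-- **`ζ(s) ≠ 0` for `0 < Re s < ½`, `15/2 < Im s ≤ 11`** (certified computation).
[folklore] -/
theorem riemannZeta_ne_zero_Zeta7hto11 {s : ℂ} (h0 : 0 < s.re) (h1 : s.re < 1 / 2)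
    (h2 : (15 / 2 : ℝ) < s.im) (h3 : s.im ≤ 11) : riemannZeta s ≠ 0 :=
  ZetaNum.riemannZeta_ne_zero_of_certCheck certZeta7hto11_ok h0 h1
    (by norm_num [certZeta7hto11, Literature.Analysis.ValidatedNumerics.Numerics.SC]; exact h2)
    (by norm_num [certZeta7hto11, Literature.Analysis.ValidatedNumerics.Numerics.SC]; exact h3)

end Literature.NumberTheory.LFunctions.ZetaLowHeightZeros.ZetaNum
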